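/-
Copyright (c) 2026 the pub-hodgecm-mathlib formalisation cell (harness21).  Prover seat hodgecm-mathlib-LH4-p14 (g3), req620 Track A «(D-RAM) FOUR-FRAME» squad
(unit U3_Laws, κ-STAGE B; brick «κ-BOX-SUM» (κ-B8 ∕ PART 2-κ) dealt by the dealer LH4-plan (g11) WORD #46 (1) ∕ #49 (1); κ owner LH4-p05 (g3); consumers: the (κ-B₀) payer of
F0P3a-p01 (g32) and this seat's (κS-B₀) assembler).  2026-09-04.
-/
import Summits.HodgeConjecture.HodgeConjecture.Theorems.F0P3cDyRamStableCountBoxReindex   -- ★ B10 PART 2 FILE 1 (LH4-p14 (g2)): brings `![…]`, `Fin` case tools, `ℚ` algebra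
import HarnessLib

/-!
# Crux `H413`, line LH4 «(D-RAM) FOUR-FRAME» road — unit U3_Laws (iii), κ-STAGE B, brick «κ-BOX-SUM» (κ-B8 ∕ PART 2-κ), FILE 3∕4 «TILING»: the foot residue and the alive glue cells tile `[k − B, k − 1]` with one sign — the leaf arithmetic, three apex orientations and the equilateral key

Cell `hodgecm-mathlib` (D-0151), FLOOR 0, crux item H413 = `stmt-HodgeConjecture-24833`, route of record `HCCMUnconditional`; squad F0∕P3c∕LH4 (req618∕req620); registered stubs served:
the κ-Stage-B children (κ-B₀) `F0P3cDyRamFourFrameU3.stub_U3_kappaCount_typeZero` and (κS-B₀) `…stub_U3_kappaSignCount_typeZero` of `Cruxes/H413/Lines/F0_P3c_DyRamFourFrame_U3_Laws.lean`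
ED. 10 (tree 4815bda2e7c89814), through the payers that feed THIS identity with the ★ κ-sockets.  THEOREMS ONLY (no `def`, no instance, no notation, no `sorry`, default heartbeats);
lane `--supports stmt-HodgeConjecture-24833` (count-neutral).  Precedent and engine: ★ B10 PART 2 «BOX RE-INDEX» `F0P3cDyRamStableCountBoxReindex{,Planes,Types}` (LH4-p14 (g2)) and
★ B8 `F0P3cDyRamStableCountSum` — the unsigned (MS) analogue `(q−1)·Σ = q^k − 1`.

THE MATHEMATICS (LH4-p05 (g3) PLAN-KMS v1 §4; per-stratum letters: ★ p856661 T-sockets (LH4-p04 (g2)), κG-C2 G-socket (LH4-p09 (g3)), κH-B2 H-socket (LH4-p06∕p08 (g3)); this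
seat's numerics `kappa_sum_tv0.v1` f242ecc3 ∕ `kappa_boxsum_leanshape.v1` 40f1a7eb, 1995∕1995 rows).  Fix a slot `i`.  The κ-weighted class count of the type-0 vertex lattices,
written stratum by stratum over the axis box, is a table with SIGN PARAMETERS: on-branch `T_p(s)`: `[i = p][2d ≤ s][2∣s][s ≤ n_p]·ω q^{s∕2}`; glued `G_p(ρ,s)`: TUBE
`[i = p]·ω q^{2ρ+s∕2−1}((q−1)[2d ≤ s] − [s+2 = 2d])` + GLUE SHELL at the apex foot (`n_legs = m < n_p = m+s`, `m < 2ρ ≤ 2m−d+1`) `ε·q^{2ρ+s∕2−c}`, `c = ⌈(2ρ−m)∕2⌉`, alive iff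
`2d ≤ s + 2c` (foot slot) resp. `d ≤ c` (cross slots); core-hanging `H(ρ)` (equilateral key only): `[d ≤ c]·εH·q^{2ρ−c}`; the core and the wild tubes' stable mass are DEAD.
THE IDENTITY: `(q − 1)·Σ_{box} = SIGN·(q^k − q^{k−B})`, `2k + d = Σn + 2`, `2B = n_i + 2(d%2) + 2 − 3d` (`B ≤ 0` ⇒ `0`), `SIGN = εH` (equilateral) ∕ the apex foot's glue entry at
slot `i`.  MECHANISM: in the slot's own (foot) plane the on-branch block `Σ_{d ≤ j ≤ ⌊n∕2⌋} q^j` is EXTENDED by the deep tubes and EATEN from below by the boundary tubes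
(`s + 2 = 2d`), telescoping to `ω·q^{[2⌊m∕2⌋+d, ⌊n∕2⌋+⌊m∕2⌋]}` when the apex excess is `≥ 2d` and to `0` otherwise; the alive glue cells are the consecutive powers above, up to
`q^{k−1}`; the two pieces tile `[k−B, k−1]` with ONE sign because «excess ≥ 2d ⇒ foot glue sign = ω» (the conductor side condition, a hypothesis here, discharged by the assemblers
with ★ `normSign_eq_one_of_fixed_of_v_sub_one_le`).  `2 ≤ d` is NEEDED (at `d = 1` the tame tube survives and the identity is false — 462 numeric counterexamples).

CONTENTS (FILE 3∕4 «TILING»: the final arithmetic, block values ⟹ `SIGN·(x^k − x^{k−B})`, no sums left).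
* `leaf_T` ∕ `leaf_Z` ∕ `leaf_TT` (leaf algebra, exponents supplied by `omega`) · `kappa_arith_apex0∕1∕2` (strict apex orientations) · `kappa_arith_equi` · dispatcher `kappa_arith`.
HONEST LABEL.  Count-neutral (`--supports stmt-HodgeConjecture-24833`); finite-sum bookkeeping over `ℚ`, nothing printed is asserted, no lattice enters; the κ-Stage-B children (κ-B₀)∕(κS-B₀) of U3 ED. 10 stay PROVER TARGETS until their payers land; `HC_CM` is proved only modulo the 7 printed citations (2 remaining named inputs: hLiu418 = `stmt-HodgeConjecture-24832`, h413 = `stmt-HodgeConjecture-24833`) until rung 0 closes.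

## References
* [Kottwitz1986BaseChangeUnits] R. E. Kottwitz, *Base change for unit elements of Hecke algebras*, Compositio Math. 60 (1986), §1 pp. 240–241 (κ-orbital integrals of units as signed lattice counts by position).
* [Rogawski1990] J. D. Rogawski, *Automorphic Representations of Unitary Groups in Three Variables*, Ann. of Math. Stud. 123 (1990), §4.9 Prop. 4.9.1 (a) p. 55, §4.10 p. 58 (the κ-signs on the classes inside a stable class).
-/

set_option autoImplicit false

namespace Summit.HodgeConjecture.HodgeConjecture.Cruxes.H413.F0P3cDyRamKappaCountBoxSumTiling

open Finset

section Tiling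


/-- Leaf algebra: one geometric difference with the target exponents. [folklore] -/
theorem leaf_T {x ε : ℚ} {a b k m : ℕ} (h1 : a = k) (h2 : b = m) : ε * (x ^ a - x ^ b) = ε * (x ^ k - x ^ m) := by
  subst h1; subst h2; rfl

/-- Leaf algebra: a dead block against a dead law (`m = k`). [folklore] -/
theorem leaf_Z {x ε : ℚ} {k m : ℕ} (h : m = k) : (0 : ℚ) = ε * (x ^ k - x ^ m) := by
  subst h; ring

/-- Leaf algebra: the foot residue and the glue window tile the law's range. [folklore] -/
theorem leaf_TT {x ω : ℚ} {a b c e k m : ℕ} (h1 : c = k) (h2 : e = a) (h3 : b = m) :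
    ω * (x ^ a - x ^ b) + ω * (x ^ c - x ^ e) = ω * (x ^ k - x ^ m) := by
  subst h1; subst h2; subst h3; ring

/-- The final tiling, strict apex `2` (legs `n₁`, apex `n₃`): block values ⟹ `SIGN·(x^k − x^(k−B))`. [folklore] -/
theorem kappa_arith_apex2 (x ω εH : ℚ) (εG : Fin 3 → Fin 3 → ℚ) {d n₁ n₃ k : ℕ} (hd : 2 ≤ d) (hlt : n₁ < n₃) (hdn : d ≤ n₁)
    (hl : n₁ % 2 = d % 2) (ha : n₃ % 2 = d % 2) (hk : 2 * k + d = n₁ + n₁ + n₃ + 2) (i : Fin 3)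
    (hω : i = 2 → n₁ + 2 * d ≤ n₃ → εG 2 2 = ω) :
    (if n₁ = n₁ ∧ n₁ = n₃ then εH * (if max 1 d ≤ (n₁ - d) / 2 + d % 2 then x ^ (2 * (n₁ / 2) + ((n₁ - d) / 2 + d % 2) + 1) - x ^ (2 * (n₁ / 2) + max 1 d) else 0) else 0) +
          ((if i = 0 then (if min n₁ n₃ / 2 + d ≤ n₁ / 2 then ω * (x ^ (n₁ / 2 + min n₁ n₃ / 2 + 1) - x ^ (2 * (min n₁ n₃ / 2) + d)) else 0) else 0) +
            (if n₁ = n₃ ∧ n₁ < n₁ ∧ (n₁ - n₁) % 2 = 0 then εG 0 i * (if max 1 (if i = 0 then d - (n₁ - n₁) / 2 else d) ≤ (n₁ - d) / 2 + d % 2 then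
              x ^ (2 * (n₁ / 2) + (n₁ - n₁) / 2 + ((n₁ - d) / 2 + d % 2) + 1) - x ^ (2 * (n₁ / 2) + (n₁ - n₁) / 2 + max 1 (if i = 0 then d - (n₁ - n₁) / 2 else d)) else 0) else 0)) +
          ((if i = 1 then (if min n₁ n₃ / 2 + d ≤ n₁ / 2 then ω * (x ^ (n₁ / 2 + min n₁ n₃ / 2 + 1) - x ^ (2 * (min n₁ n₃ / 2) + d)) else 0) else 0) +
            (if n₁ = n₃ ∧ n₁ < n₁ ∧ (n₁ - n₁) % 2 = 0 then εG 1 i * (if max 1 (if i = 1 then d - (n₁ - n₁) / 2 else d) ≤ (n₁ - d) / 2 + d % 2 then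
              x ^ (2 * (n₁ / 2) + (n₁ - n₁) / 2 + ((n₁ - d) / 2 + d % 2) + 1) - x ^ (2 * (n₁ / 2) + (n₁ - n₁) / 2 + max 1 (if i = 1 then d - (n₁ - n₁) / 2 else d)) else 0) else 0)) +
          ((if i = 2 then (if min n₁ n₁ / 2 + d ≤ n₃ / 2 then ω * (x ^ (n₃ / 2 + min n₁ n₁ / 2 + 1) - x ^ (2 * (min n₁ n₁ / 2) + d)) else 0) else 0) +
            (if n₁ = n₁ ∧ n₁ < n₃ ∧ (n₃ - n₁) % 2 = 0 then εG 2 i * (if max 1 (if i = 2 then d - (n₃ - n₁) / 2 else d) ≤ (n₁ - d) / 2 + d % 2 then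
              x ^ (2 * (n₁ / 2) + (n₃ - n₁) / 2 + ((n₁ - d) / 2 + d % 2) + 1) - x ^ (2 * (n₁ / 2) + (n₃ - n₁) / 2 + max 1 (if i = 2 then d - (n₃ - n₁) / 2 else d)) else 0) else 0))
      = (if n₁ = n₁ ∧ n₁ = n₃ then εH else if n₁ = n₃ then εG 0 i else if n₁ = n₃ then εG 1 i else εG 2 i) *
        (x ^ k - x ^ (k - ((![n₁, n₁, n₃] : Fin 3 → ℕ) i + 2 * (d % 2) + 2 - 3 * d) / 2)) := by
  have hd1 : 1 ≤ d := by omega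
  have hpar : (n₃ - n₁) % 2 = 0 := by omega
  have hne0 : ¬ (n₁ = n₃) := by omega
  simp only [hne0, hlt, hpar, min_eq_left hlt.le, and_true, false_and, and_false, ↓reduceIte, zero_add, add_zero, lt_self_iff_false, min_self]
  fin_cases i <;> simp only [Fin.zero_eta, Fin.mk_one, Fin.reduceFinMk, Fin.isValue, Fin.reduceEq, ↓reduceIte, Matrix.cons_val_zero, Matrix.cons_val_one, Matrix.cons_val_two, Matrix.head_cons, Matrix.tail_cons, add_zero, zero_add]
  · split_ifs <;> (try simp only [mul_zero, add_zero, zero_add]) <;> first | (exfalso; omega) | exact leaf_TT (by omega) (by omega) (by omega) | exact leaf_T (by omega) (by omega) | exact leaf_Z (by omega)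
  · split_ifs <;> (try simp only [mul_zero, add_zero, zero_add]) <;> first | (exfalso; omega) | exact leaf_TT (by omega) (by omega) (by omega) | exact leaf_T (by omega) (by omega) | exact leaf_Z (by omega)
  · by_cases hdeep : n₁ + 2 * d ≤ n₃
    · rw [hω rfl hdeep]
      split_ifs <;> (try simp only [mul_zero, add_zero, zero_add]) <;> first | (exfalso; omega) | exact leaf_TT (by omega) (by omega) (by omega) | exact leaf_T (by omega) (by omega)
    · split_ifs <;> (try simp only [mul_zero, add_zero, zero_add]) <;> first | (exfalso; omega) | exact leaf_TT (by omega) (by omega) (by omega) | exact leaf_T (by omega) (by omega) | exact leaf_Z (by omega)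

set_option maxHeartbeats 400000 in
/-- The final tiling, strict apex `1` (legs `n₁`, apex `n₂`): block values ⟹ `SIGN·(x^k − x^(k−B))`. [folklore] -/
theorem kappa_arith_apex1 (x ω εH : ℚ) (εG : Fin 3 → Fin 3 → ℚ) {d n₁ n₂ k : ℕ} (hd : 2 ≤ d) (hlt : n₁ < n₂) (hdn : d ≤ n₁)
    (hl : n₁ % 2 = d % 2) (ha : n₂ % 2 = d % 2) (hk : 2 * k + d = n₁ + n₂ + n₁ + 2) (i : Fin 3)
    (hω : i = 1 → n₁ + 2 * d ≤ n₂ → εG 1 1 = ω) :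
    (if n₁ = n₂ ∧ n₂ = n₁ then εH * (if max 1 d ≤ (n₁ - d) / 2 + d % 2 then x ^ (2 * (n₁ / 2) + ((n₁ - d) / 2 + d % 2) + 1) - x ^ (2 * (n₁ / 2) + max 1 d) else 0) else 0) +
          ((if i = 0 then (if min n₂ n₁ / 2 + d ≤ n₁ / 2 then ω * (x ^ (n₁ / 2 + min n₂ n₁ / 2 + 1) - x ^ (2 * (min n₂ n₁ / 2) + d)) else 0) else 0) +
            (if n₂ = n₁ ∧ n₂ < n₁ ∧ (n₁ - n₂) % 2 = 0 then εG 0 i * (if max 1 (if i = 0 then d - (n₁ - n₂) / 2 else d) ≤ (n₂ - d) / 2 + d % 2 then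
              x ^ (2 * (n₂ / 2) + (n₁ - n₂) / 2 + ((n₂ - d) / 2 + d % 2) + 1) - x ^ (2 * (n₂ / 2) + (n₁ - n₂) / 2 + max 1 (if i = 0 then d - (n₁ - n₂) / 2 else d)) else 0) else 0)) +
          ((if i = 1 then (if min n₁ n₁ / 2 + d ≤ n₂ / 2 then ω * (x ^ (n₂ / 2 + min n₁ n₁ / 2 + 1) - x ^ (2 * (min n₁ n₁ / 2) + d)) else 0) else 0) +
            (if n₁ = n₁ ∧ n₁ < n₂ ∧ (n₂ - n₁) % 2 = 0 then εG 1 i * (if max 1 (if i = 1 then d - (n₂ - n₁) / 2 else d) ≤ (n₁ - d) / 2 + d % 2 then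
              x ^ (2 * (n₁ / 2) + (n₂ - n₁) / 2 + ((n₁ - d) / 2 + d % 2) + 1) - x ^ (2 * (n₁ / 2) + (n₂ - n₁) / 2 + max 1 (if i = 1 then d - (n₂ - n₁) / 2 else d)) else 0) else 0)) +
          ((if i = 2 then (if min n₁ n₂ / 2 + d ≤ n₁ / 2 then ω * (x ^ (n₁ / 2 + min n₁ n₂ / 2 + 1) - x ^ (2 * (min n₁ n₂ / 2) + d)) else 0) else 0) +
            (if n₁ = n₂ ∧ n₁ < n₁ ∧ (n₁ - n₁) % 2 = 0 then εG 2 i * (if max 1 (if i = 2 then d - (n₁ - n₁) / 2 else d) ≤ (n₁ - d) / 2 + d % 2 then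
              x ^ (2 * (n₁ / 2) + (n₁ - n₁) / 2 + ((n₁ - d) / 2 + d % 2) + 1) - x ^ (2 * (n₁ / 2) + (n₁ - n₁) / 2 + max 1 (if i = 2 then d - (n₁ - n₁) / 2 else d)) else 0) else 0))
      = (if n₁ = n₂ ∧ n₂ = n₁ then εH else if n₂ = n₁ then εG 0 i else if n₁ = n₁ then εG 1 i else εG 2 i) *
        (x ^ k - x ^ (k - ((![n₁, n₂, n₁] : Fin 3 → ℕ) i + 2 * (d % 2) + 2 - 3 * d) / 2)) := by
  have hd1 : 1 ≤ d := by omega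
  have hpar : (n₂ - n₁) % 2 = 0 := by omega
  have hne0 : ¬ (n₁ = n₂) := by omega
  have hne1 : ¬ (n₂ = n₁) := by omega
  simp only [hne0, hne1, hlt, hpar, min_eq_right hlt.le, min_eq_left hlt.le, and_true, false_and, and_false, ↓reduceIte, zero_add, add_zero, lt_self_iff_false, min_self]
  fin_cases i <;> simp only [Fin.zero_eta, Fin.mk_one, Fin.reduceFinMk, Fin.isValue, Fin.reduceEq, ↓reduceIte, Matrix.cons_val_zero, Matrix.cons_val_one, Matrix.cons_val_two, Matrix.head_cons, Matrix.tail_cons, add_zero, zero_add]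
  · split_ifs <;> (try simp only [mul_zero, add_zero, zero_add]) <;> first | (exfalso; omega) | exact leaf_TT (by omega) (by omega) (by omega) | exact leaf_T (by omega) (by omega) | exact leaf_Z (by omega)
  · by_cases hdeep : n₁ + 2 * d ≤ n₂
    · rw [hω rfl hdeep]
      split_ifs <;> (try simp only [mul_zero, add_zero, zero_add]) <;> first | (exfalso; omega) | exact leaf_TT (by omega) (by omega) (by omega) | exact leaf_T (by omega) (by omega)
    · split_ifs <;> (try simp only [mul_zero, add_zero, zero_add]) <;> first | (exfalso; omega) | exact leaf_TT (by omega) (by omega) (by omega) | exact leaf_T (by omega) (by omega) | exact leaf_Z (by omega)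
  · split_ifs <;> (try simp only [mul_zero, add_zero, zero_add]) <;> first | (exfalso; omega) | exact leaf_TT (by omega) (by omega) (by omega) | exact leaf_T (by omega) (by omega) | exact leaf_Z (by omega)

/-- The final tiling, strict apex `0` (legs `n₂`, apex `n₁`): block values ⟹ `SIGN·(x^k − x^(k−B))`. [folklore] -/
theorem kappa_arith_apex0 (x ω εH : ℚ) (εG : Fin 3 → Fin 3 → ℚ) {d n₂ n₁ k : ℕ} (hd : 2 ≤ d) (hlt : n₂ < n₁) (hdn : d ≤ n₂)
    (hl : n₂ % 2 = d % 2) (ha : n₁ % 2 = d % 2) (hk : 2 * k + d = n₁ + n₂ + n₂ + 2) (i : Fin 3)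
    (hω : i = 0 → n₂ + 2 * d ≤ n₁ → εG 0 0 = ω) :
    (if n₁ = n₂ ∧ n₂ = n₂ then εH * (if max 1 d ≤ (n₁ - d) / 2 + d % 2 then x ^ (2 * (n₁ / 2) + ((n₁ - d) / 2 + d % 2) + 1) - x ^ (2 * (n₁ / 2) + max 1 d) else 0) else 0) +
          ((if i = 0 then (if min n₂ n₂ / 2 + d ≤ n₁ / 2 then ω * (x ^ (n₁ / 2 + min n₂ n₂ / 2 + 1) - x ^ (2 * (min n₂ n₂ / 2) + d)) else 0) else 0) +
            (if n₂ = n₂ ∧ n₂ < n₁ ∧ (n₁ - n₂) % 2 = 0 then εG 0 i * (if max 1 (if i = 0 then d - (n₁ - n₂) / 2 else d) ≤ (n₂ - d) / 2 + d % 2 then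
              x ^ (2 * (n₂ / 2) + (n₁ - n₂) / 2 + ((n₂ - d) / 2 + d % 2) + 1) - x ^ (2 * (n₂ / 2) + (n₁ - n₂) / 2 + max 1 (if i = 0 then d - (n₁ - n₂) / 2 else d)) else 0) else 0)) +
          ((if i = 1 then (if min n₁ n₂ / 2 + d ≤ n₂ / 2 then ω * (x ^ (n₂ / 2 + min n₁ n₂ / 2 + 1) - x ^ (2 * (min n₁ n₂ / 2) + d)) else 0) else 0) +
            (if n₁ = n₂ ∧ n₁ < n₂ ∧ (n₂ - n₁) % 2 = 0 then εG 1 i * (if max 1 (if i = 1 then d - (n₂ - n₁) / 2 else d) ≤ (n₁ - d) / 2 + d % 2 then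
              x ^ (2 * (n₁ / 2) + (n₂ - n₁) / 2 + ((n₁ - d) / 2 + d % 2) + 1) - x ^ (2 * (n₁ / 2) + (n₂ - n₁) / 2 + max 1 (if i = 1 then d - (n₂ - n₁) / 2 else d)) else 0) else 0)) +
          ((if i = 2 then (if min n₁ n₂ / 2 + d ≤ n₂ / 2 then ω * (x ^ (n₂ / 2 + min n₁ n₂ / 2 + 1) - x ^ (2 * (min n₁ n₂ / 2) + d)) else 0) else 0) +
            (if n₁ = n₂ ∧ n₁ < n₂ ∧ (n₂ - n₁) % 2 = 0 then εG 2 i * (if max 1 (if i = 2 then d - (n₂ - n₁) / 2 else d) ≤ (n₁ - d) / 2 + d % 2 then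
              x ^ (2 * (n₁ / 2) + (n₂ - n₁) / 2 + ((n₁ - d) / 2 + d % 2) + 1) - x ^ (2 * (n₁ / 2) + (n₂ - n₁) / 2 + max 1 (if i = 2 then d - (n₂ - n₁) / 2 else d)) else 0) else 0))
      = (if n₁ = n₂ ∧ n₂ = n₂ then εH else if n₂ = n₂ then εG 0 i else if n₁ = n₂ then εG 1 i else εG 2 i) *
        (x ^ k - x ^ (k - ((![n₁, n₂, n₂] : Fin 3 → ℕ) i + 2 * (d % 2) + 2 - 3 * d) / 2)) := by
  have hd1 : 1 ≤ d := by omega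
  have hpar : (n₁ - n₂) % 2 = 0 := by omega
  have hne0 : ¬ (n₁ = n₂) := by omega
  simp only [hne0, hlt, hpar, min_eq_right hlt.le, and_true, false_and, ↓reduceIte, zero_add, add_zero, min_self]
  fin_cases i <;> simp only [Fin.zero_eta, Fin.mk_one, Fin.reduceFinMk, Fin.isValue, Fin.reduceEq, ↓reduceIte, Matrix.cons_val_zero, Matrix.cons_val_one, Matrix.cons_val_two, Matrix.head_cons, Matrix.tail_cons, add_zero, zero_add]
  · by_cases hdeep : n₂ + 2 * d ≤ n₁
    · rw [hω rfl hdeep]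
      split_ifs <;> (try simp only [mul_zero, add_zero, zero_add]) <;> first | (exfalso; omega) | exact leaf_TT (by omega) (by omega) (by omega) | exact leaf_T (by omega) (by omega)
    · split_ifs <;> (try simp only [mul_zero, add_zero, zero_add]) <;> first | (exfalso; omega) | exact leaf_TT (by omega) (by omega) (by omega) | exact leaf_T (by omega) (by omega) | exact leaf_Z (by omega)
  · split_ifs <;> (try simp only [mul_zero, add_zero, zero_add]) <;> first | (exfalso; omega) | exact leaf_TT (by omega) (by omega) (by omega) | exact leaf_T (by omega) (by omega) | exact leaf_Z (by omega)
  · split_ifs <;> (try simp only [mul_zero, add_zero, zero_add]) <;> first | (exfalso; omega) | exact leaf_TT (by omega) (by omega) (by omega) | exact leaf_T (by omega) (by omega) | exact leaf_Z (by omega)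

/-- The final tiling, equilateral key: only the H window is alive. [folklore] -/
theorem kappa_arith_equi (x ω εH : ℚ) (εG : Fin 3 → Fin 3 → ℚ) {d n₁ k : ℕ} (hd : 2 ≤ d) (hdn : d ≤ n₁) (hl : n₁ % 2 = d % 2)
    (hk : 2 * k + d = n₁ + n₁ + n₁ + 2) (i : Fin 3) :
    (if n₁ = n₁ ∧ n₁ = n₁ then εH * (if max 1 d ≤ (n₁ - d) / 2 + d % 2 then x ^ (2 * (n₁ / 2) + ((n₁ - d) / 2 + d % 2) + 1) - x ^ (2 * (n₁ / 2) + max 1 d) else 0) else 0) +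
          ((if i = 0 then (if min n₁ n₁ / 2 + d ≤ n₁ / 2 then ω * (x ^ (n₁ / 2 + min n₁ n₁ / 2 + 1) - x ^ (2 * (min n₁ n₁ / 2) + d)) else 0) else 0) +
            (if n₁ = n₁ ∧ n₁ < n₁ ∧ (n₁ - n₁) % 2 = 0 then εG 0 i * (if max 1 (if i = 0 then d - (n₁ - n₁) / 2 else d) ≤ (n₁ - d) / 2 + d % 2 then
              x ^ (2 * (n₁ / 2) + (n₁ - n₁) / 2 + ((n₁ - d) / 2 + d % 2) + 1) - x ^ (2 * (n₁ / 2) + (n₁ - n₁) / 2 + max 1 (if i = 0 then d - (n₁ - n₁) / 2 else d)) else 0) else 0)) +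
          ((if i = 1 then (if min n₁ n₁ / 2 + d ≤ n₁ / 2 then ω * (x ^ (n₁ / 2 + min n₁ n₁ / 2 + 1) - x ^ (2 * (min n₁ n₁ / 2) + d)) else 0) else 0) +
            (if n₁ = n₁ ∧ n₁ < n₁ ∧ (n₁ - n₁) % 2 = 0 then εG 1 i * (if max 1 (if i = 1 then d - (n₁ - n₁) / 2 else d) ≤ (n₁ - d) / 2 + d % 2 then
              x ^ (2 * (n₁ / 2) + (n₁ - n₁) / 2 + ((n₁ - d) / 2 + d % 2) + 1) - x ^ (2 * (n₁ / 2) + (n₁ - n₁) / 2 + max 1 (if i = 1 then d - (n₁ - n₁) / 2 else d)) else 0) else 0)) +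
          ((if i = 2 then (if min n₁ n₁ / 2 + d ≤ n₁ / 2 then ω * (x ^ (n₁ / 2 + min n₁ n₁ / 2 + 1) - x ^ (2 * (min n₁ n₁ / 2) + d)) else 0) else 0) +
            (if n₁ = n₁ ∧ n₁ < n₁ ∧ (n₁ - n₁) % 2 = 0 then εG 2 i * (if max 1 (if i = 2 then d - (n₁ - n₁) / 2 else d) ≤ (n₁ - d) / 2 + d % 2 then
              x ^ (2 * (n₁ / 2) + (n₁ - n₁) / 2 + ((n₁ - d) / 2 + d % 2) + 1) - x ^ (2 * (n₁ / 2) + (n₁ - n₁) / 2 + max 1 (if i = 2 then d - (n₁ - n₁) / 2 else d)) else 0) else 0))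
      = (if n₁ = n₁ ∧ n₁ = n₁ then εH else if n₁ = n₁ then εG 0 i else if n₁ = n₁ then εG 1 i else εG 2 i) *
        (x ^ k - x ^ (k - ((![n₁, n₁, n₁] : Fin 3 → ℕ) i + 2 * (d % 2) + 2 - 3 * d) / 2)) := by
  have hd1 : 1 ≤ d := by omega
  simp only [and_true, false_and, and_false, ↓reduceIte, add_zero, lt_self_iff_false, min_self]
  fin_cases i <;> simp only [Fin.zero_eta, Fin.mk_one, Fin.reduceFinMk, Fin.isValue, Fin.reduceEq, ↓reduceIte, Matrix.cons_val_zero, Matrix.cons_val_one, Matrix.cons_val_two, Matrix.head_cons, Matrix.tail_cons, add_zero] <;> split_ifs <;> (try simp only [mul_zero, add_zero, zero_add]) <;> first | (exfalso; omega) | exact leaf_TT (by omega) (by omega) (by omega) | exact leaf_T (by omega) (by omega) | exact leaf_Z (by omega)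

/-- The final tiling for an isoceles key (dispatch on the orientation). [folklore] -/
theorem kappa_arith (x ω εH : ℚ) (εG : Fin 3 → Fin 3 → ℚ) {d n₁ n₂ n₃ k : ℕ} (hd : 2 ≤ d)
    (hiso : (n₁ = n₂ ∧ n₁ ≤ n₃) ∨ (n₁ = n₃ ∧ n₁ ≤ n₂) ∨ (n₂ = n₃ ∧ n₂ ≤ n₁))
    (hdn : d ≤ min n₁ (min n₂ n₃)) (h1 : n₁ % 2 = d % 2) (h2 : n₂ % 2 = d % 2) (h3 : n₃ % 2 = d % 2)
    (hk : 2 * k + d = n₁ + n₂ + n₃ + 2) (i : Fin 3)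
    (hω0 : i = 0 → n₂ = n₃ → n₂ + 2 * d ≤ n₁ → εG 0 0 = ω) (hω1 : i = 1 → n₁ = n₃ → n₁ + 2 * d ≤ n₂ → εG 1 1 = ω)
    (hω2 : i = 2 → n₁ = n₂ → n₁ + 2 * d ≤ n₃ → εG 2 2 = ω) :
    (if n₁ = n₂ ∧ n₂ = n₃ then εH * (if max 1 d ≤ (n₁ - d) / 2 + d % 2 then x ^ (2 * (n₁ / 2) + ((n₁ - d) / 2 + d % 2) + 1) - x ^ (2 * (n₁ / 2) + max 1 d) else 0) else 0) +
          ((if i = 0 then (if min n₂ n₃ / 2 + d ≤ n₁ / 2 then ω * (x ^ (n₁ / 2 + min n₂ n₃ / 2 + 1) - x ^ (2 * (min n₂ n₃ / 2) + d)) else 0) else 0) +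
            (if n₂ = n₃ ∧ n₂ < n₁ ∧ (n₁ - n₂) % 2 = 0 then εG 0 i * (if max 1 (if i = 0 then d - (n₁ - n₂) / 2 else d) ≤ (n₂ - d) / 2 + d % 2 then
              x ^ (2 * (n₂ / 2) + (n₁ - n₂) / 2 + ((n₂ - d) / 2 + d % 2) + 1) - x ^ (2 * (n₂ / 2) + (n₁ - n₂) / 2 + max 1 (if i = 0 then d - (n₁ - n₂) / 2 else d)) else 0) else 0)) +
          ((if i = 1 then (if min n₁ n₃ / 2 + d ≤ n₂ / 2 then ω * (x ^ (n₂ / 2 + min n₁ n₃ / 2 + 1) - x ^ (2 * (min n₁ n₃ / 2) + d)) else 0) else 0) +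
            (if n₁ = n₃ ∧ n₁ < n₂ ∧ (n₂ - n₁) % 2 = 0 then εG 1 i * (if max 1 (if i = 1 then d - (n₂ - n₁) / 2 else d) ≤ (n₁ - d) / 2 + d % 2 then
              x ^ (2 * (n₁ / 2) + (n₂ - n₁) / 2 + ((n₁ - d) / 2 + d % 2) + 1) - x ^ (2 * (n₁ / 2) + (n₂ - n₁) / 2 + max 1 (if i = 1 then d - (n₂ - n₁) / 2 else d)) else 0) else 0)) +
          ((if i = 2 then (if min n₁ n₂ / 2 + d ≤ n₃ / 2 then ω * (x ^ (n₃ / 2 + min n₁ n₂ / 2 + 1) - x ^ (2 * (min n₁ n₂ / 2) + d)) else 0) else 0) +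
            (if n₁ = n₂ ∧ n₁ < n₃ ∧ (n₃ - n₁) % 2 = 0 then εG 2 i * (if max 1 (if i = 2 then d - (n₃ - n₁) / 2 else d) ≤ (n₁ - d) / 2 + d % 2 then
              x ^ (2 * (n₁ / 2) + (n₃ - n₁) / 2 + ((n₁ - d) / 2 + d % 2) + 1) - x ^ (2 * (n₁ / 2) + (n₃ - n₁) / 2 + max 1 (if i = 2 then d - (n₃ - n₁) / 2 else d)) else 0) else 0))
      = (if n₁ = n₂ ∧ n₂ = n₃ then εH else if n₂ = n₃ then εG 0 i else if n₁ = n₃ then εG 1 i else εG 2 i) *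
        (x ^ k - x ^ (k - ((![n₁, n₂, n₃] : Fin 3 → ℕ) i + 2 * (d % 2) + 2 - 3 * d) / 2)) := by
  have hm₁ : min n₁ (min n₂ n₃) ≤ n₁ := min_le_left _ _
  have hm₂ : min n₁ (min n₂ n₃) ≤ n₂ := le_trans (min_le_right _ _) (min_le_left _ _)
  have hm₃ : min n₁ (min n₂ n₃) ≤ n₃ := le_trans (min_le_right _ _) (min_le_right _ _)
  rcases hiso with ⟨h12, h13⟩ | ⟨h13, h12⟩ | ⟨h23, h21⟩
  · subst h12
    rcases Nat.lt_or_ge n₁ n₃ with hlt | hge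
    · exact kappa_arith_apex2 x ω εH εG hd hlt (le_trans hdn hm₁) h1 h3 hk i (fun hi h => hω2 hi rfl h)
    · have h : n₁ = n₃ := le_antisymm h13 hge
      subst h
      exact kappa_arith_equi x ω εH εG hd (le_trans hdn hm₁) h1 hk i
  · subst h13
    rcases Nat.lt_or_ge n₁ n₂ with hlt | hge
    · exact kappa_arith_apex1 x ω εH εG hd hlt (le_trans hdn hm₁) h1 h2 hk i (fun hi h => hω1 hi rfl h)
    · have h : n₁ = n₂ := le_antisymm h12 hge
      subst h
      exact kappa_arith_equi x ω εH εG hd (le_trans hdn hm₁) h1 hk i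
  · subst h23
    rcases Nat.lt_or_ge n₂ n₁ with hlt | hge
    · exact kappa_arith_apex0 x ω εH εG hd hlt (le_trans hdn hm₂) h2 h1 hk i (fun hi h => hω0 hi rfl h)
    · have h : n₂ = n₁ := le_antisymm h21 hge
      subst h
      exact kappa_arith_equi x ω εH εG hd (le_trans hdn hm₂) h2 hk i

end Tiling

end Summit.HodgeConjecture.HodgeConjecture.Cruxes.H413.F0P3cDyRamKappaCountBoxSumTiling
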